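import Literature.Geometry.Lorentzian.CarterThroatCoefficient
import Literature.Analysis.ODE.EulerZoneGrowth
import Literature.Analysis.ODE.SoninEnvelope
import HarnessLib

/-!
# A priori transport across the near-horizon throat of Carter's equation in the blown-up chart
(namespace `Literature.Geometry.Lorentzian.Kerr`.)

Companion of `CarterThroatCoefficient.lean`. In the blown-up radius `x = (r − r₊)/(r₊ − r₋)` the
scalar radial Teukolsky / Carter equation on sub-extremal Kerr is `W″ = Q W`,
`Q = (L x(x+1) − k² − ¼)/(x(x+1))²`, `k = k₀ + ω x(2r₊ + d x)`, `d = r₊ − r₋`, `L = Λ − 2amω`,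
`k₀ = (ω − mω₊)/(2κ)`. On a bounded frequency box (`|L| ≤ L₀`, `|ω(2r₊ + 2dx)| ≤ G` for `x ≤ X₀`)
the throat `θ ≤ x ≤ X₀` (`X₀/θ ≍ κ⁻¹` in the application) splits into

* the EULER ZONE `x ≥ c|k₀|`, where `x²|Q| ≤ n²` with a box constant `n`
  (`throat_sq_mul_abs_coeff_le`), so `|W| + x|W′|` grows at most like `(X₀/θ)^{n+1}` inward
  (`Literature.Analysis.ODE.norm_add_mul_norm_deriv_le_of_euler`);
* the OSCILLATORY POCKET `θ ≤ x ≤ c|k₀|` (present only when `|k₀|` is large, i.e. off the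
  threshold `ω = mω₊` at small `κ`), where `−Q > 0` is non-increasing
  (`throat_pocket_numerator_bounds`, `throat_negCoeff_deriv_numerator_nonpos`), so Sonin's envelope
  `|W|² + |W′|²/(−Q)` is non-decreasing and `|W|` does not grow at all inward
  (`Literature.Analysis.ODE.norm_sq_le_soninEnvelope_of_ge`).

The result `throat_norm_le` is the a priori bound
`‖W x‖ ≤ (1 + 2c(1 + θ⁻¹)) · 2n (X₀/θ)^{n+1} · (‖W X₀‖ + X₀‖W′ X₀‖)` for all `x ∈ [θ, X₀]`,
UNIFORM in `k₀` — the elementary substitute, when only polynomial constants matter, for the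
Teukolsky–Press near-horizon matched asymptotics. Hypotheses are pointwise `HasDerivAt` statements
on `x > 0`; the coefficient enters through a hypothesis `Q x = …` so that any syntactic form of the
normal form can be plugged in. Everything is proved.

## References
* S. A. Teukolsky, W. H. Press, Astrophys. J. 193 (1974), 443–461, §II.
* F. W. J. Olver, *Asymptotics and Special Functions* (1974), Ch. 6. Key `Olver1974`.
* G. Szegő, *Orthogonal Polynomials*, Thm 7.31.1 (Sonin–Pólya).
-/

noncomputable section

open Set

namespace Literature.Geometry.Lorentzian

namespace Kerr

section Throat

variable {W W' : ℝ → ℂ} {Q : ℝ → ℝ} {L k₀ ω rp d θ X₀ c L₀ G : ℝ} {n : ℕ}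

/-- **Euler-zone step.** Under the hypotheses of `throat_norm_le`, on `[max θ (c|k₀|), X₀]` the
Euler amplitude `‖W x‖ + x‖W′ x‖` is at most `2n (X₀/θ)^{n+1} (‖W X₀‖ + X₀‖W′ X₀‖)`. [folklore] -/
theorem throat_euler_le
    (hQ : ∀ x, 0 < x → Q x =
      (L * (x * (x + 1)) - (k₀ + ω * x * (2 * rp + d * x)) ^ 2 - 1 / 4) / (x * (x + 1)) ^ 2)
    (hW : ∀ x, 0 < x → HasDerivAt W (W' x) x ∧ HasDerivAt W' ((Q x : ℂ) * W x) x)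
    (hθ : 0 < θ) (hθX : θ ≤ X₀) (hL : |L| ≤ L₀) (hc : 0 < c) (hkX : c * |k₀| ≤ X₀)
    (hg : ∀ x ∈ Icc 0 X₀, |ω * (2 * rp + d * x)| ≤ G ∧ |ω * (2 * rp + 2 * d * x)| ≤ G)
    (hn : 1 ≤ n) (hK : L₀ + 1 / 4 + 2 / c ^ 2 + 2 * G ^ 2 ≤ (n : ℝ) ^ 2) :
    ∀ x ∈ Icc (max θ (c * |k₀|)) X₀,
      ‖W x‖ + x * ‖W' x‖ ≤ 2 * n * (X₀ / θ) ^ (n + 1) * (‖W X₀‖ + X₀ * ‖W' X₀‖) := by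
  intro x hx
  set x₁ := max θ (c * |k₀|) with hx₁
  have hx₁θ : θ ≤ x₁ := le_max_left _ _
  have hx₁pos : 0 < x₁ := hθ.trans_le hx₁θ
  have hx₁X : x₁ ≤ X₀ := max_le hθX hkX
  have hX : 0 < X₀ := hx₁pos.trans_le hx₁X
  -- the solution and the inverse-square bound on `[x₁, X₀]`
  have hy : ∀ z ∈ Icc x₁ X₀, HasDerivAt W (W' z) z ∧
      HasDerivAt W' ((fun s ↦ (Q s : ℂ)) z * W z) z := fun z hz ↦ hW z (hx₁pos.trans_le hz.1)
  have hq : ∀ z ∈ Icc x₁ X₀, z ^ 2 * ‖(fun s ↦ (Q s : ℂ)) z‖ ≤ (n : ℝ) ^ 2 := by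
    intro z hz
    have hz0 : 0 < z := hx₁pos.trans_le hz.1
    have hcz : c * |k₀| ≤ z := (le_max_right _ _).trans hz.1
    have hgz := (hg z ⟨hz0.le, hz.2⟩).1
    simp only [Complex.norm_real, Real.norm_eq_abs]
    rw [hQ z hz0, show k₀ + ω * z * (2 * rp + d * z) = k₀ + z * (ω * (2 * rp + d * z)) by ring]
    exact (throat_sq_mul_abs_coeff_le hz0 hc hcz hL hgz).trans hK
  have key := Literature.Analysis.ODE.norm_add_mul_norm_deriv_le_of_euler hx₁pos hn hy hq
    ⟨hx₁X, le_rfl⟩ hx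
  -- `X₀/x₁ ≤ X₀/θ`
  have hratio : (X₀ / x₁) ^ (n + 1) ≤ (X₀ / θ) ^ (n + 1) :=
    pow_le_pow_left₀ (div_nonneg hX.le hx₁pos.le) (div_le_div_of_nonneg_left hX.le hθ hx₁θ) _
  have hA : 0 ≤ ‖W X₀‖ + X₀ * ‖W' X₀‖ := by positivity
  calc ‖W x‖ + x * ‖W' x‖ ≤ 2 * n * (X₀ / x₁) ^ (n + 1) * (‖W X₀‖ + X₀ * ‖W' X₀‖) := key
    _ ≤ 2 * n * (X₀ / θ) ^ (n + 1) * (‖W X₀‖ + X₀ * ‖W' X₀‖) := by gcongr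

/-- **Pocket step.** Under the hypotheses of `throat_norm_le`, if the pocket is non-trivial
(`θ < c|k₀|`) then for every `x ∈ [θ, c|k₀|]`:
`‖W x‖² ≤ ‖W(c|k₀|)‖² + 4c²(c|k₀| + 1)² ‖W′(c|k₀|)‖²` — Sonin's envelope for the non-increasing
positive coefficient `−Q` on the pocket, and `−Q(c|k₀|) ≥ 1/(4c²(c|k₀|+1)²)`. [folklore] -/
theorem throat_pocket_le
    (hQ : ∀ x, 0 < x → Q x =
      (L * (x * (x + 1)) - (k₀ + ω * x * (2 * rp + d * x)) ^ 2 - 1 / 4) / (x * (x + 1)) ^ 2)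
    (hW : ∀ x, 0 < x → HasDerivAt W (W' x) x ∧ HasDerivAt W' ((Q x : ℂ) * W x) x)
    (hθ : 0 < θ) (hL : |L| ≤ L₀) (hc : 0 < c) (hkX : c * |k₀| ≤ X₀)
    (hg : ∀ x ∈ Icc 0 X₀, |ω * (2 * rp + d * x)| ≤ G ∧ |ω * (2 * rp + 2 * d * x)| ≤ G)
    (hcG : c * G ≤ 1 / 144) (hcL : 32 * L₀ * c ^ 2 ≤ min 1 θ) (hpocket : θ < c * |k₀|) :
    ∀ x ∈ Icc θ (c * |k₀|),
      ‖W x‖ ^ 2 ≤ ‖W (c * |k₀|)‖ ^ 2 + 4 * c ^ 2 * (c * |k₀| + 1) ^ 2 * ‖W' (c * |k₀|)‖ ^ 2 := by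
  intro x hx
  set x₁ := c * |k₀| with hx₁_def
  have hL0 : 0 ≤ L₀ := (abs_nonneg L).trans hL
  have hk0 : 0 < |k₀| := by
    by_contra h
    have : |k₀| = 0 := le_antisymm (not_lt.1 h) (abs_nonneg _)
    rw [hx₁_def, this, mul_zero] at hpocket
    exact lt_irrefl _ (hθ.trans hpocket)
  -- `1/c < |k₀|/θ`, hence `L₀ c |k₀| ≤ k₀²/32` and `L₀ c² k₀² ≤ k₀²/32`
  have hc2 : 32 * L₀ * c ^ 2 ≤ θ := hcL.trans (min_le_right _ _)
  have hc1 : 32 * L₀ * c ^ 2 ≤ 1 := hcL.trans (min_le_left _ _)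
  have hℓ₁ : L₀ * (x₁ * (x₁ + 1)) ≤ k₀ ^ 2 / 16 := by
    have e : k₀ ^ 2 = |k₀| ^ 2 := (sq_abs k₀).symm
    have h1 : L₀ * x₁ ^ 2 ≤ k₀ ^ 2 / 32 := by
      rw [hx₁_def, e]; nlinarith [sq_nonneg |k₀|]
    have h2 : L₀ * x₁ ≤ k₀ ^ 2 / 32 := by
      -- `θ · L₀ c |k₀| ≤ 32 L₀ c² · ... `: use `θ < c|k₀|`
      have h3 : L₀ * x₁ * θ ≤ L₀ * x₁ * x₁ :=
        mul_le_mul_of_nonneg_left hpocket.le (by rw [hx₁_def]; positivity)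
      have h4 : L₀ * x₁ * x₁ * 32 ≤ k₀ ^ 2 * θ := by
        rw [hx₁_def, e]
        have := mul_le_mul_of_nonneg_right hc2 (sq_nonneg |k₀|)
        nlinarith
      have h5 : L₀ * x₁ * 32 * θ ≤ k₀ ^ 2 / 32 * 32 * θ := by nlinarith [h3, h4]
      have h6 := le_of_mul_le_mul_right h5 hθ
      linarith
    nlinarith
  -- pointwise pocket facts on `[θ, x₁]`
  set P : ℝ → ℝ := fun y ↦ ((k₀ + ω * y * (2 * rp + d * y)) ^ 2 + 1 / 4 - L * (y * (y + 1))) /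
    (y * (y + 1)) ^ 2 with hP_def
  set P' : ℝ → ℝ := fun y ↦
    (((2 * (k₀ + ω * y * (2 * rp + d * y)) * (ω * (2 * rp + 2 * d * y)) - L * (2 * y + 1)) *
          (y * (y + 1)) ^ 2 -
        ((k₀ + ω * y * (2 * rp + d * y)) ^ 2 + 1 / 4 - L * (y * (y + 1))) *
          (2 * (y * (y + 1)) * (2 * y + 1))) /
      ((y * (y + 1)) ^ 2) ^ 2) with hP'_def
  have hfacts : ∀ z ∈ Icc θ x₁, 0 < z ∧
      k₀ ^ 2 / 4 + 1 / 4 ≤ (k₀ + ω * z * (2 * rp + d * z)) ^ 2 + 1 / 4 - L * (z * (z + 1)) ∧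
      |k₀ + ω * z * (2 * rp + d * z)| ≤ 2 * |k₀| ∧
      |L| * (z * (z + 1)) ≤ k₀ ^ 2 / 16 ∧ |ω * (2 * rp + 2 * d * z)| ≤ G := by
    intro z hz
    have hz0 : 0 < z := hθ.trans_le hz.1
    have hzX : z ∈ Icc 0 X₀ := ⟨hz0.le, hz.2.trans hkX⟩
    obtain ⟨hg1, hg2⟩ := hg z hzX
    have hG : 0 ≤ G := (abs_nonneg _).trans hg1
    -- `|t| ≤ |k₀|/144`
    have ht : |z * (ω * (2 * rp + d * z))| ≤ |k₀| / 144 := by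
      rw [abs_mul, abs_of_pos hz0]
      calc z * |ω * (2 * rp + d * z)| ≤ x₁ * G := mul_le_mul hz.2 hg1 (abs_nonneg _) (by positivity)
        _ = c * G * |k₀| := by rw [hx₁_def]; ring
        _ ≤ 1 / 144 * |k₀| := mul_le_mul_of_nonneg_right hcG (abs_nonneg _)
        _ = |k₀| / 144 := by ring
    -- `|ℓ| ≤ k₀²/16`
    have hℓ : |L| * (z * (z + 1)) ≤ k₀ ^ 2 / 16 := by
      have h1 : |L| * (z * (z + 1)) ≤ L₀ * (x₁ * (x₁ + 1)) := by
        apply mul_le_mul hL _ (by positivity) hL0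
        nlinarith [hz.2, hz0]
      exact h1.trans hℓ₁
    have hℓ' : |L * (z * (z + 1))| ≤ k₀ ^ 2 / 16 := by
      rwa [abs_mul, abs_of_pos (by positivity : 0 < z * (z + 1))]
    obtain ⟨hN, hk⟩ := throat_pocket_numerator_bounds ht hℓ'
    refine ⟨hz0, ?_, ?_, hℓ, hg2⟩
    · convert hN using 1; ring
    · convert hk using 2; ring
  -- the Sonin hypotheses
  have hS : ∀ z ∈ Icc θ x₁, HasDerivAt W (W' z) z ∧ HasDerivAt W' (-(P z : ℂ) * W z) z ∧
      HasDerivAt P (P' z) z := by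
    intro z hz
    obtain ⟨hz0, -, -, -, -⟩ := hfacts z hz
    obtain ⟨h1, h2⟩ := hW z hz0
    have hQP : (Q z : ℂ) = -(P z : ℂ) := by
      rw [← Complex.ofReal_neg, hQ z hz0, hP_def]
      push_cast
      ring
    refine ⟨h1, by rw [← hQP]; exact h2, ?_⟩
    have hz1 : z * (z + 1) ≠ 0 := by positivity
    exact hasDerivAt_throat_negCoeff L k₀ ω rp d hz1
  have hPpos : ∀ z ∈ Icc θ x₁, 0 < P z := by
    intro z hz
    obtain ⟨hz0, hN, -, -, -⟩ := hfacts z hz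
    simp only [hP_def]
    exact div_pos (by nlinarith [sq_nonneg k₀]) (by positivity)
  have hP'le : ∀ z ∈ Icc θ x₁, P' z ≤ 0 := by
    intro z hz
    obtain ⟨hz0, hN, hk, hℓ, hk'⟩ := hfacts z hz
    simp only [hP'_def]
    refine div_nonpos_of_nonpos_of_nonneg ?_ (by positivity)
    exact throat_negCoeff_deriv_numerator_nonpos hz0 hz.2 hcG hk' hk hℓ (by linarith)
  -- Sonin's envelope bound from `x₁` down to `x`
  have hx₁mem : x₁ ∈ Icc θ x₁ := right_mem_Icc.2 hpocket.le
  have hson := Literature.Analysis.ODE.norm_sq_le_soninEnvelope_of_ge hS hPpos hP'le hx hx₁mem hx.2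
  -- `1/P(x₁) ≤ 4c²(x₁+1)²`
  obtain ⟨hx₁0, hN₁, -, -, -⟩ := hfacts x₁ hx₁mem
  have hPx₁ : 1 / (4 * c ^ 2 * (x₁ + 1) ^ 2) ≤ P x₁ := by
    simp only [hP_def]
    rw [div_le_div_iff₀ (by positivity) (by positivity)]
    have e : x₁ ^ 2 = c ^ 2 * k₀ ^ 2 := by rw [hx₁_def, mul_pow, sq_abs]
    have h0 : 0 ≤ 4 * c ^ 2 * (x₁ + 1) ^ 2 := by positivity
    have h1 := mul_le_mul_of_nonneg_right hN₁ h0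
    have h2 : x₁ ^ 2 * (x₁ + 1) ^ 2 = c ^ 2 * k₀ ^ 2 * (x₁ + 1) ^ 2 := by rw [e]
    have h3 : 0 ≤ c ^ 2 * (x₁ + 1) ^ 2 := by positivity
    nlinarith [h1, h2, h3]
  have hdiv : ‖W' x₁‖ ^ 2 / P x₁ ≤ 4 * c ^ 2 * (x₁ + 1) ^ 2 * ‖W' x₁‖ ^ 2 := by
    rw [div_le_iff₀ (hPpos x₁ hx₁mem)]
    have h0 : 0 ≤ 4 * c ^ 2 * (x₁ + 1) ^ 2 * ‖W' x₁‖ ^ 2 := by positivity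
    calc ‖W' x₁‖ ^ 2 = 4 * c ^ 2 * (x₁ + 1) ^ 2 * ‖W' x₁‖ ^ 2 * (1 / (4 * c ^ 2 * (x₁ + 1) ^ 2)) := by
          field_simp
      _ ≤ 4 * c ^ 2 * (x₁ + 1) ^ 2 * ‖W' x₁‖ ^ 2 * P x₁ := mul_le_mul_of_nonneg_left hPx₁ h0
  linarith

/-- **A priori bound across the throat, uniform in `k₀`.** Let `W″ = Q W` on `x > 0` with
`Q(x) = (L x(x+1) − (k₀ + ωx(2r₊ + dx))² − ¼)/(x(x+1))²` (Carter's equation in the blown-up chart),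
and let `0 < θ ≤ X₀`, `|L| ≤ L₀`, `0 < c`, `c|k₀| ≤ X₀`, `|ω(2r₊ + dx)|, |ω(2r₊ + 2dx)| ≤ G` on
`[0, X₀]`, `cG ≤ 1/144`, `32 L₀ c² ≤ min 1 θ`, `1 ≤ n`, `L₀ + ¼ + 2/c² + 2G² ≤ n²`. Then for all
`x ∈ [θ, X₀]`:
`‖W x‖ ≤ (1 + 2c(1 + θ⁻¹)) · 2n (X₀/θ)^{n+1} · (‖W X₀‖ + X₀‖W′ X₀‖)`
(Euler zone `throat_euler_le` down to `max θ (c|k₀|)`, then the pocket `throat_pocket_le`).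
[folklore] -/
theorem throat_norm_le
    (hQ : ∀ x, 0 < x → Q x =
      (L * (x * (x + 1)) - (k₀ + ω * x * (2 * rp + d * x)) ^ 2 - 1 / 4) / (x * (x + 1)) ^ 2)
    (hW : ∀ x, 0 < x → HasDerivAt W (W' x) x ∧ HasDerivAt W' ((Q x : ℂ) * W x) x)
    (hθ : 0 < θ) (hθX : θ ≤ X₀) (hL : |L| ≤ L₀) (hc : 0 < c) (hkX : c * |k₀| ≤ X₀)
    (hg : ∀ x ∈ Icc 0 X₀, |ω * (2 * rp + d * x)| ≤ G ∧ |ω * (2 * rp + 2 * d * x)| ≤ G)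
    (hcG : c * G ≤ 1 / 144) (hcL : 32 * L₀ * c ^ 2 ≤ min 1 θ) (hn : 1 ≤ n)
    (hK : L₀ + 1 / 4 + 2 / c ^ 2 + 2 * G ^ 2 ≤ (n : ℝ) ^ 2) :
    ∀ x ∈ Icc θ X₀, ‖W x‖ ≤
      (1 + 2 * c * (1 + θ⁻¹)) * (2 * n * (X₀ / θ) ^ (n + 1) * (‖W X₀‖ + X₀ * ‖W' X₀‖)) := by
  intro x hx
  set A := 2 * n * (X₀ / θ) ^ (n + 1) * (‖W X₀‖ + X₀ * ‖W' X₀‖) with hA_def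
  have hX : 0 < X₀ := hθ.trans_le hθX
  have hA : 0 ≤ A := by positivity
  have hfac : 1 ≤ 1 + 2 * c * (1 + θ⁻¹) := le_add_of_nonneg_right (by positivity)
  have hE := throat_euler_le hQ hW hθ hθX hL hc hkX hg hn hK
  rcases le_or_gt (max θ (c * |k₀|)) x with hxz | hxz
  · -- `x` in the Euler zone
    have h1 := hE x ⟨hxz, hx.2⟩
    have h2 : ‖W x‖ ≤ A := by
      have : 0 ≤ x * ‖W' x‖ := mul_nonneg (hθ.le.trans hx.1) (norm_nonneg _)
      linarith
    calc ‖W x‖ ≤ A := h2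
      _ = 1 * A := (one_mul A).symm
      _ ≤ (1 + 2 * c * (1 + θ⁻¹)) * A := mul_le_mul_of_nonneg_right hfac hA
  · -- `x` in the pocket: `θ ≤ x < c|k₀|`
    have hpocket : θ < c * |k₀| := by
      rcases lt_max_iff.1 (hx.1.trans_lt hxz) with h | h
      · exact absurd h (lt_irrefl θ)
      · exact h
    set x₁ := c * |k₀| with hx₁_def
    have hxx₁ : x ≤ x₁ := hxz.le.trans (max_le hpocket.le le_rfl)
    have hP := throat_pocket_le hQ hW hθ hL hc hkX hg hcG hcL hpocket x ⟨hx.1, hxx₁⟩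
    -- the Euler bound at `x₁`
    have h1 := hE x₁ ⟨(max_le hpocket.le le_rfl), hkX⟩
    have hx₁θ : θ ≤ x₁ := hpocket.le
    have hx₁0 : 0 < x₁ := hθ.trans_le hx₁θ
    have hWx₁ : ‖W x₁‖ ≤ A := by
      have : 0 ≤ x₁ * ‖W' x₁‖ := by positivity
      linarith
    have hW'x₁ : x₁ * ‖W' x₁‖ ≤ A := by linarith [norm_nonneg (W x₁)]
    -- `x₁ + 1 ≤ x₁ (1 + θ⁻¹)`
    have hx₁1 : x₁ + 1 ≤ x₁ * (1 + θ⁻¹) := by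
      rw [mul_add, mul_one, add_le_add_iff_left]
      calc (1 : ℝ) = θ * θ⁻¹ := (mul_inv_cancel₀ hθ.ne').symm
        _ ≤ x₁ * θ⁻¹ := mul_le_mul_of_nonneg_right hx₁θ (inv_pos.2 hθ).le
    have hB : 4 * c ^ 2 * (x₁ + 1) ^ 2 * ‖W' x₁‖ ^ 2 ≤ (2 * c * (1 + θ⁻¹) * A) ^ 2 := by
      have h3 : (x₁ + 1) * ‖W' x₁‖ ≤ (1 + θ⁻¹) * A :=
        calc (x₁ + 1) * ‖W' x₁‖ ≤ x₁ * (1 + θ⁻¹) * ‖W' x₁‖ :=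
              mul_le_mul_of_nonneg_right hx₁1 (norm_nonneg _)
          _ = (1 + θ⁻¹) * (x₁ * ‖W' x₁‖) := by ring
          _ ≤ (1 + θ⁻¹) * A := mul_le_mul_of_nonneg_left hW'x₁ (by positivity)
      have h4 : 0 ≤ (x₁ + 1) * ‖W' x₁‖ := by positivity
      calc 4 * c ^ 2 * (x₁ + 1) ^ 2 * ‖W' x₁‖ ^ 2 = (2 * c) ^ 2 * ((x₁ + 1) * ‖W' x₁‖) ^ 2 := by ring
        _ ≤ (2 * c) ^ 2 * ((1 + θ⁻¹) * A) ^ 2 := by gcongr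
        _ = (2 * c * (1 + θ⁻¹) * A) ^ 2 := by ring
    have hsq : ‖W x‖ ^ 2 ≤ ((1 + 2 * c * (1 + θ⁻¹)) * A) ^ 2 := by
      have h5 : ‖W x₁‖ ^ 2 ≤ A ^ 2 := pow_le_pow_left₀ (norm_nonneg _) hWx₁ 2
      have h6 : 0 ≤ 2 * c * (1 + θ⁻¹) * A := by positivity
      calc ‖W x‖ ^ 2 ≤ ‖W x₁‖ ^ 2 + 4 * c ^ 2 * (x₁ + 1) ^ 2 * ‖W' x₁‖ ^ 2 := hP
        _ ≤ A ^ 2 + (2 * c * (1 + θ⁻¹) * A) ^ 2 := add_le_add h5 hB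
        _ ≤ ((1 + 2 * c * (1 + θ⁻¹)) * A) ^ 2 := by nlinarith [mul_nonneg hA h6]
    exact (pow_le_pow_iff_left₀ (norm_nonneg _) (by positivity) two_ne_zero).1 hsq

end Throat

end Kerr

end Literature.Geometry.Lorentzian

end
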